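import Summits.BirchSwinnertonDyer.BirchSwinnertonDyer.Theorems.ErratumRoadFiveFittingExtensionInequality
import Summits.BirchSwinnertonDyer.BirchSwinnertonDyer.Theorems.ErratumRoadFiveBoundedCongruenceLimit
import Summits.BirchSwinnertonDyer.Rank1Residual.X11b.HalvesReceptacle
import HarnessLib

/-!
# Crux K1 `CumulativeHeegnerInclusionAtThree` (stmt-BirchSwinnertonDyer-24198) / crux A (stmt-26896): the
# MODULE-LEVEL layer door — from layer data (finite-error control + a Fitting membership of a layer
# element + a layer congruence) to the layer-tower hypothesis (LT) of `…LayerTower`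

Width seat bsd-line-chl-k1-p1-w2 g5 (`--supports stmt-BirchSwinnertonDyer-24198`). PURE COMMUTATIVE ALGEBRA
over arbitrary commutative rings `R → S` (theorems only; no definition, no named fact, no `sorry`);
ROUTE-INDEPENDENT (no `Theses` import), so that a line's `_of` may import it next to
`Theorems/CumulativeHeegnerLeopoldtCumulativeHeegnerInclusionAtThreeLayerTower.lean` (p637184) without
stacking on a route-importing module. Nothing about Selmer groups, control theorems, Kolyvagin systems or
`L`-functions is asserted; BSD is not proved by any of this; no summit statement is proved by this seat.

## What (memo LAYER-TOWER-DOOR-w2g5.md §2, in the kernel)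

Fix a ring map `φ : R → S` (intended `Λ = ℤ₃⟦T⟧ → R₀⟦T⟧`), a finite `R`-module `X` (intended
`X_{∅,0}(𝔭′)`), `L t : S` (intended the BDP function and `3^μ`), `ω : R` (intended the layer polynomial
`ω_m = (1+T)^{3^m} − 1`), an ideal `𝔟 ⊆ S` containing `φ(ω)` (intended `(3^m) + (ω_m)`), and LAYER DATA:

* an exact sequence of `R`-modules `C → X ⧸ ω X → N → 0` (intended: anticyclotomic control at layer `m`,
  `N` = the layer-`m` Selmer dual, `C` = the dual of the cokernel of restriction) with `C` generated by
  `g` elements and killed by `d ∈ R` (intended `d = 3^a`, `a`, `g` independent of `m`);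
* `θ ∈ Fitt₀(N)·S` (intended: the layer-`m` output of an equivariant Kolyvagin argument);
* `t · L ∈ (θ) + 𝔟` (intended: the layer reciprocity `θ_m ≡ unit · 3^μ L (mod 3^m, ω_m)`).

Then `φ(d^g) · t · L ∈ Fitt₀(X)·S + 𝔟` (`mul_mem_map_fittingIdeal_sup_of_layerData`), i.e. at the
intended values EXACTLY the layer-`m` instance of hypothesis (LT) of
`…LayerTower.temperedHeegnerInclusionAtThree_of_fittingLayerTower` with exponent `a·g + μ` — uniform in
`m` as soon as `a, g, μ` are. The three algebra steps are the tree's: `Fitt₀(C)·Fitt₀(N) ⊆ Fitt₀(X/ωX)`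
and `d^g ∈ Fitt₀(C)` (`FittingExtension.span_pow_mul_fittingIdeal_zero_le_of_exact`, Stacks 07ZA (2),(4)),
`Fitt₀(X/ωX) ⊆ Fitt₀(X) + (ω)` (`BoundedCongruenceLimit.fittingIdeal_quotient_le_sup`, Stacks 07ZA (3)),
then transport along `φ`. Also recorded: the tower form (`∀ m`) `forall_mul_mem_map_fittingIdeal_sup_of_layerData`,
and its instance over `Λ = ℤ_p⟦T⟧ → R₀⟦T⟧` (`toUnr`, any prime `p`) with `ω_m = (1+T)^{p^m} − 1`,
`𝔟_m = (p^m) + (ω_m)`, `d = p^a`, `t = p^μ`: `forall_pow_mul_mem_map_fittingIdeal_sup_layer` — whose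
conclusion `p^{a g + μ} · L ∈ Fitt₀(X)·R₀⟦T⟧ + (p^m) + (ω_m)` is LITERALLY the layer-`m` clause of (LT).

References: [StacksProject] Tag 07ZA; [MazurTate1987] §1; [KimKurihara2021] §1; [BertoliniDarmon1990] §2.
-/

set_option linter.dupNamespace false
set_option autoImplicit false

namespace Summit.BirchSwinnertonDyer.BirchSwinnertonDyer.Theorems.CumulativeHeegnerInclusionAtThreeLayerTowerControl

open Literature.RingTheory.FittingIdeal
open Summit.BirchSwinnertonDyer.BirchSwinnertonDyer.Theorems

universe u u' v w w'

variable {R : Type u} [CommRing R] {S : Type u'} [CommRing S] (φ : R →+* S)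
  {X : Type v} [AddCommGroup X] [Module R X] [Module.Finite R X]

/-- **Control with finite error, Fitting form, one layer.** For an exact sequence of `R`-modules
`C → X ⧸ ωX → N → 0` with `C` generated by `g` elements and killed by `d`:
`d^g · Fitt₀(N) ⊆ Fitt₀(X) + (ω)`. [cite: StacksProject, Tag 07ZA (2), (3), (4)] -/
theorem span_pow_mul_fittingIdeal_le_sup_of_control (ω d : R) {g : ℕ}
    {C : Type w} [AddCommGroup C] [Module R C] {N : Type w'} [AddCommGroup N] [Module R N]
    [Module.Finite R N]
    (j : C →ₗ[R] (X ⧸ (Ideal.span {ω} • (⊤ : Submodule R X))))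
    (q : (X ⧸ (Ideal.span {ω} • (⊤ : Submodule R X))) →ₗ[R] N)
    (hjq : Function.Exact j q) (hq : Function.Surjective q)
    (hgen : ∃ κ : Fin g → C, Submodule.span R (Set.range κ) = ⊤) (hd : d ∈ Module.annihilator R C) :
    Ideal.span {d ^ g} * Module.fittingIdeal R N 0 ≤ Module.fittingIdeal R X 0 ⊔ Ideal.span {ω} :=
  (FittingExtension.span_pow_mul_fittingIdeal_zero_le_of_exact j q hjq hq hgen hd).trans
    (BoundedCongruenceLimit.fittingIdeal_quotient_le_sup (Ideal.span {ω}) X 0)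

/-- Transport of the one-layer control inequality along `φ : R → S`:
`φ(d^g) · (Fitt₀(N)·S) ⊆ Fitt₀(X)·S + (φ ω)`. [cite: StacksProject, Tag 07ZA] -/
theorem span_map_pow_mul_map_fittingIdeal_le_sup_of_control (ω d : R) {g : ℕ}
    {C : Type w} [AddCommGroup C] [Module R C] {N : Type w'} [AddCommGroup N] [Module R N]
    [Module.Finite R N]
    (j : C →ₗ[R] (X ⧸ (Ideal.span {ω} • (⊤ : Submodule R X))))
    (q : (X ⧸ (Ideal.span {ω} • (⊤ : Submodule R X))) →ₗ[R] N)
    (hjq : Function.Exact j q) (hq : Function.Surjective q)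
    (hgen : ∃ κ : Fin g → C, Submodule.span R (Set.range κ) = ⊤) (hd : d ∈ Module.annihilator R C) :
    Ideal.span {φ (d ^ g)} * (Module.fittingIdeal R N 0).map φ ≤
      (Module.fittingIdeal R X 0).map φ ⊔ Ideal.span {φ ω} := by
  have h := Ideal.map_mono (f := φ)
    (span_pow_mul_fittingIdeal_le_sup_of_control ω d j q hjq hq hgen hd)
  rw [Ideal.map_mul, Ideal.map_sup, Ideal.map_span, Set.image_singleton, Ideal.map_span,
    Set.image_singleton] at h
  exact h

/-- **The module-level layer door, one layer.** Layer data `C → X ⧸ ωX → N → 0` exact (`C`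
`g`-generated, killed by `d`), a layer element `θ ∈ Fitt₀(N)·S` and a layer congruence
`t · L ∈ (θ) + 𝔟` with `φ ω ∈ 𝔟` give `φ(d^g) · t · L ∈ Fitt₀(X)·S + 𝔟` — the layer-`m` instance of
the hypothesis (LT) of `…LayerTower.temperedHeegnerInclusionAtThree_of_fittingLayerTower` when
`R → S = Λ → R₀⟦T⟧`, `ω = ω_m`, `𝔟 = (3^m) + (ω_m)`, `d = 3^a`, `t = 3^μ`.
[cite: MazurTate1987, §1] [cite: StacksProject, Tag 07ZA] -/
theorem mul_mem_map_fittingIdeal_sup_of_layerData (ω d : R) {g : ℕ}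
    {C : Type w} [AddCommGroup C] [Module R C] {N : Type w'} [AddCommGroup N] [Module R N]
    [Module.Finite R N]
    (j : C →ₗ[R] (X ⧸ (Ideal.span {ω} • (⊤ : Submodule R X))))
    (q : (X ⧸ (Ideal.span {ω} • (⊤ : Submodule R X))) →ₗ[R] N)
    (hjq : Function.Exact j q) (hq : Function.Surjective q)
    (hgen : ∃ κ : Fin g → C, Submodule.span R (Set.range κ) = ⊤) (hd : d ∈ Module.annihilator R C)
    {𝔟 : Ideal S} (hω : φ ω ∈ 𝔟) {θ t L : S} (hθ : θ ∈ (Module.fittingIdeal R N 0).map φ)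
    (hrec : t * L ∈ Ideal.span {θ} ⊔ 𝔟) :
    φ (d ^ g) * (t * L) ∈ (Module.fittingIdeal R X 0).map φ ⊔ 𝔟 := by
  -- `φ(d^g) · θ ∈ Fitt₀(X)·S + (φ ω) ⊆ Fitt₀(X)·S + 𝔟`
  have hθ' : φ (d ^ g) * θ ∈ (Module.fittingIdeal R X 0).map φ ⊔ 𝔟 := by
    have h1 : φ (d ^ g) * θ ∈ Ideal.span {φ (d ^ g)} * (Module.fittingIdeal R N 0).map φ :=
      Ideal.mul_mem_mul (Ideal.mem_span_singleton_self _) hθ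
    have h2 := span_map_pow_mul_map_fittingIdeal_le_sup_of_control φ ω d j q hjq hq hgen hd h1
    exact (sup_le_sup_left ((Ideal.span_singleton_le_iff_mem _).mpr hω) _) h2
  -- `t · L = r θ + b`
  obtain ⟨y, hy, b, hb, hyb⟩ := Submodule.mem_sup.mp hrec
  obtain ⟨r, rfl⟩ := Ideal.mem_span_singleton'.mp hy
  rw [← hyb, mul_add, ← mul_assoc, mul_comm (φ (d ^ g)) r, mul_assoc]
  exact Ideal.add_mem _ (Ideal.mul_mem_left _ r hθ') (Ideal.mem_sup_right (Ideal.mul_mem_left _ _ hb))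

/-- **The module-level layer door, tower form.** If the layer data exist at EVERY layer `m` with the
SAME `d` and `g` — exact `C_m → X ⧸ ω_m X → N_m → 0`, `C_m` `g`-generated and killed by `d`, layer
elements `θ_m ∈ Fitt₀(N_m)·S`, layer congruences `t · L ∈ (θ_m) + 𝔟_m` with `φ ω_m ∈ 𝔟_m` — then
`φ(d^g) · t · L ∈ Fitt₀(X)·S + 𝔟_m` for every `m`: with `R → S = Λ → R₀⟦T⟧`, `𝔟_m = (3^m) + (ω_m)`,
`d = 3^a`, `t = 3^μ` this is hypothesis (LT) of `…LayerTower` with the `m`-UNIFORM exponent `a·g + μ`.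
[cite: MazurTate1987, §1] [cite: KimKurihara2021, §1] [cite: StacksProject, Tag 07ZA] -/
theorem forall_mul_mem_map_fittingIdeal_sup_of_layerData (ω : ℕ → R) (d : R) {g : ℕ}
    (C : ℕ → Type w) [∀ m, AddCommGroup (C m)] [∀ m, Module R (C m)]
    (N : ℕ → Type w') [∀ m, AddCommGroup (N m)] [∀ m, Module R (N m)] [∀ m, Module.Finite R (N m)]
    (j : ∀ m, C m →ₗ[R] (X ⧸ (Ideal.span {ω m} • (⊤ : Submodule R X))))
    (q : ∀ m, (X ⧸ (Ideal.span {ω m} • (⊤ : Submodule R X))) →ₗ[R] N m)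
    (hjq : ∀ m, Function.Exact (j m) (q m)) (hq : ∀ m, Function.Surjective (q m))
    (hgen : ∀ m, ∃ κ : Fin g → C m, Submodule.span R (Set.range κ) = ⊤)
    (hd : ∀ m, d ∈ Module.annihilator R (C m))
    (𝔟 : ℕ → Ideal S) (hω : ∀ m, φ (ω m) ∈ 𝔟 m) (θ : ℕ → S) {t L : S}
    (hθ : ∀ m, θ m ∈ (Module.fittingIdeal R (N m) 0).map φ)
    (hrec : ∀ m, t * L ∈ Ideal.span {θ m} ⊔ 𝔟 m) (m : ℕ) :
    φ (d ^ g) * (t * L) ∈ (Module.fittingIdeal R X 0).map φ ⊔ 𝔟 m :=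
  mul_mem_map_fittingIdeal_sup_of_layerData φ (ω m) d (j m) (q m) (hjq m) (hq m) (hgen m) (hd m)
    (hω m) (hθ m) (hrec m)

/-! ### The instance over `Λ = ℤ_p⟦T⟧ → R₀⟦T⟧` -/

section Unr

open Literature.NumberTheory.EllipticCurves Summit.BirchSwinnertonDyer.Rank1Residual.X11b

variable {p : ℕ} [Fact p.Prime] {Y : Type v} [AddCommGroup Y] [Module (IwasawaAlgebra p) Y]
  [Module.Finite (IwasawaAlgebra p) Y]

/-- `toUnr` maps the layer polynomial of `Λ` to that of `R₀⟦T⟧`: `φ(ω_m) = (1+T)^{p^m} − 1`. [folklore] -/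
theorem map_toUnr_omega (m : ℕ) :
    PowerSeries.map (Halves.toUnr p) ((1 + PowerSeries.X) ^ (p ^ m) - 1 : IwasawaAlgebra p) =
      ((1 + PowerSeries.X) ^ (p ^ m) - 1 : UnrSeries p) := by
  rw [map_sub, map_pow, map_add, map_one, PowerSeries.map_X]

/-- `toUnr` maps `C(p^a)^g ∈ Λ` to `p^{a·g} ∈ R₀⟦T⟧`. [folklore] -/
theorem map_toUnr_C_pow_pow (a g : ℕ) :
    PowerSeries.map (Halves.toUnr p) ((PowerSeries.C ((p : ℤ_[p]) ^ a)) ^ g) =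
      ((p : ℕ) : UnrSeries p) ^ (a * g) := by
  rw [map_pow, PowerSeries.map_C, map_pow, map_natCast, map_pow, map_natCast, ← pow_mul]

/-- **The module-level layer door over `Λ → R₀⟦T⟧`, tower form, in the currency of (LT).** Layer data
at every `m` with UNIFORM `a`, `g`, `μ` — exact `C_m → Y ⧸ ω_m Y → N_m → 0` over `Λ = ℤ_p⟦T⟧`
(`ω_m = (1+T)^{p^m} − 1`), `C_m` `g`-generated and killed by `p^a`, layer elements
`θ_m ∈ Fitt₀(N_m)·R₀⟦T⟧`, layer congruences `p^μ · L ∈ (θ_m) + (p^m) + (ω_m)` in `R₀⟦T⟧` — give, for every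
`m`, `p^{a g + μ} · L ∈ Fitt₀(Y)·R₀⟦T⟧ + (p^m) + (ω_m)`: at `p = 3`, `Y = X_{∅,0}(𝔭′)` this is hypothesis
(LT) of `…LayerTower.temperedHeegnerInclusionAtThree_of_fittingLayerTower` (exponent `a·g + μ`).
Nothing about the existence of such layer data is asserted. [cite: MazurTate1987, §1]
[cite: KimKurihara2021, §1] [cite: StacksProject, Tag 07ZA] -/
theorem forall_pow_mul_mem_map_fittingIdeal_sup_layer (a g μ : ℕ)
    (C : ℕ → Type w) [∀ m, AddCommGroup (C m)] [∀ m, Module (IwasawaAlgebra p) (C m)]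
    (N : ℕ → Type w') [∀ m, AddCommGroup (N m)] [∀ m, Module (IwasawaAlgebra p) (N m)]
    [∀ m, Module.Finite (IwasawaAlgebra p) (N m)]
    (j : ∀ m, C m →ₗ[IwasawaAlgebra p]
      (Y ⧸ (Ideal.span {((1 + PowerSeries.X) ^ (p ^ m) - 1 : IwasawaAlgebra p)} •
        (⊤ : Submodule (IwasawaAlgebra p) Y))))
    (q : ∀ m, (Y ⧸ (Ideal.span {((1 + PowerSeries.X) ^ (p ^ m) - 1 : IwasawaAlgebra p)} •
        (⊤ : Submodule (IwasawaAlgebra p) Y))) →ₗ[IwasawaAlgebra p] N m)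
    (hjq : ∀ m, Function.Exact (j m) (q m)) (hq : ∀ m, Function.Surjective (q m))
    (hgen : ∀ m, ∃ κ : Fin g → C m, Submodule.span (IwasawaAlgebra p) (Set.range κ) = ⊤)
    (hd : ∀ m, (PowerSeries.C ((p : ℤ_[p]) ^ a) : IwasawaAlgebra p) ∈
      Module.annihilator (IwasawaAlgebra p) (C m))
    (θ : ℕ → UnrSeries p) {L : UnrSeries p}
    (hθ : ∀ m, θ m ∈ (Module.fittingIdeal (IwasawaAlgebra p) (N m) 0).map
      (PowerSeries.map (Halves.toUnr p)))
    (hrec : ∀ m, ((p : ℕ) : UnrSeries p) ^ μ * L ∈ Ideal.span {θ m} ⊔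
      Ideal.span {((p : ℕ) : UnrSeries p) ^ m} ⊔
        Ideal.span {((1 + PowerSeries.X) ^ (p ^ m) - 1 : UnrSeries p)}) (m : ℕ) :
    ((p : ℕ) : UnrSeries p) ^ (a * g + μ) * L ∈
      (Module.fittingIdeal (IwasawaAlgebra p) Y 0).map (PowerSeries.map (Halves.toUnr p)) ⊔
        Ideal.span {((p : ℕ) : UnrSeries p) ^ m} ⊔
          Ideal.span {((1 + PowerSeries.X) ^ (p ^ m) - 1 : UnrSeries p)} := by
  have h := forall_mul_mem_map_fittingIdeal_sup_of_layerData (PowerSeries.map (Halves.toUnr p))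
    (X := Y) (fun m ↦ ((1 + PowerSeries.X) ^ (p ^ m) - 1 : IwasawaAlgebra p))
    (PowerSeries.C ((p : ℤ_[p]) ^ a)) C N j q hjq hq hgen hd
    (fun m ↦ Ideal.span {((p : ℕ) : UnrSeries p) ^ m} ⊔
      Ideal.span {((1 + PowerSeries.X) ^ (p ^ m) - 1 : UnrSeries p)})
    (fun m ↦ by
      rw [map_toUnr_omega]
      exact Ideal.mem_sup_right (Ideal.mem_span_singleton_self _))
    θ (t := ((p : ℕ) : UnrSeries p) ^ μ) (L := L) hθ (fun m ↦ by simpa only [sup_assoc] using hrec m) m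
  rw [map_toUnr_C_pow_pow, ← mul_assoc, ← pow_add] at h
  simpa only [sup_assoc] using h

end Unr

end Summit.BirchSwinnertonDyer.BirchSwinnertonDyer.Theorems.CumulativeHeegnerInclusionAtThreeLayerTowerControl
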